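import Mathlib
import HarnessLib
import HarnessLib.Audit
import Summits.ValiantsHypothesis.Statement
import Literature.Computability.AlgebraicComplexity.PermanentIrreducible
import Literature.Computability.AlgebraicComplexity.ArithCircuitProofs
import Literature.Computability.AlgebraicComplexity.ValiantConjectureProofs
import HarnessLib.Audit.Status.Attr

/-!
Route: OneNatPerBit

DORMANT since 2026-08-22T06:22:11Z (reconciler: no traction for 5.1 d (last activity item-evidence-added at 2026-08-17T02:36:56Z); parked, not closed — `ledger route dormant route-ValiantsHypothesis-OneNatPerBit --off` to reactivate) — unstaffed, not closed; items shared with open routes are served there. `ledger route dormant <id> --off` reactivates.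

# Route OneNatPerBit — one nat per bit — size-s circuits see per_n at squared cosine ≤
e^(-n)·s^(log2 e)·poly(n); its weakest shadow, a correlation gap at polynomial size, gives VP ≠ VNP

It suffices to show X = CorrelationGap (card correlation-law-nat-per-bit, spine): for every c there
is n₀ such that for all n ≥ n₀ every fan-in-two arithmetic circuit P over ℂ in the n² variables x_ij
with at most n^c gates satisfies corr²(P.eval, per_n) ≤ 1/2, where corr²(f, per_n) := |Σ_σ
coeff_(x_σ) f|² / (n!·Σ_m |coeff_m f|²) ∈ [0,1] is the squared cosine, in coefficient space, between
f and the permanent (junk monomials of f count in the denominator; corr²(per_n) = 1, corr²(det_n) =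
0, corr²(Π_i row-sum_i) = n!/n^n). X is the weakest shadow of the card's ONE-NAT-PER-BIT LAW γ(n,s)
:= sup_(size ≤ s) corr² ≤ poly(n)·e^(−n)·s^(log₂ e) (crux CorrelationLaw), calibrated by
Carlen–Lieb–Loss at s ≈ n² (intercept n!/n^n), by the k-column dynamic programme at every scale
(gain e per bit of width) and by Ryser/Glynn at s = 2^n (corr = 1). X refutes p-computability of per
(per is its own direction), hence VP_ℂ ≠ VNP_ℂ by Valiant's per ∈ VNP. Honest strength label: X is
of border-VH strength (it forbids per_n even in the ℓ²-direction closure of polynomial-size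
outputs), stronger than the summit; the route bets on the exchange rate, checkable below X at every
(n, s).
Lean: `∀ c : ℕ, ∃ n₀ : ℕ, ∀ n ≥ n₀, ∀ P : Literature.Computability.AlgebraicComplexity.ArithCircuit
ℂ (Fin n × Fin n), P.IsFanInTwo → P.size ≤ n ^ c → 2 * ‖∑ σ : Equiv.Perm (Fin n), MvPolynomial.coeff
(Literature.Computability.AlgebraicComplexity.permMonomial σ) P.eval‖ ^ 2 ≤ (n.factorial : ℝ) *
P.eval.support.sum (fun m => ‖MvPolynomial.coeff m P.eval‖ ^ 2)`

## Assembly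
Pure logic plus two proved tree facts (sorry-free in the planner's Sketch.lean, deciding theorem
`closes (hX : CorrelationGap) (hR : GapRefutesPer) : ValiantsHypothesis`): GapRefutesPer turns X
into ¬IsVPFamily (per_n over ℂ); if VP ℂ = VNP ℂ then perFamily ℂ ∈ VP ℂ by the proved
`perFamily_mem_VNP_holds ℂ`, hence IsVPFamily per by the proved renaming bridge
`mem_VP_ofFintype_iff_holds`, contradiction. The law enters only through SharpImpliesExp ∘
LawImpliesGap (CorrelationLaw ⇒ ExpCorrelationLaw ⇒ X); ABPCorrelationLaw, MonotoneCorrelationLaw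
and the four anchors calibrate and test the law below X.

Rationale: WHY THIS LINE. Trade VANISHING for an ANGLE: every equation-based route (flattenings, GCT, shifted
partials, natural-proof distinguishers) certifies Zariski non-membership and is blind to how CLOSE
small circuits come to per_n; the correlation profile γ(n,s) turns that into a number with three
independent exact calibrations — an analysts' sharp constant (CarlenLiebLoss2006 Thm 1.1, |per F| ≤
N!/N^(N/2)·Π|f_j|, proved by heat-flow interpolation or an elementary induction on K rows, Thm 3.1),
a combinatorial DP family (width 2^k tracking k columns: corr² = (n−k)!/(n−k)^(n−k) ≈ e^(k−n)), and
Ryser/Glynn (Glynn2010; JerrumSnir1982 §4.3 for the exact monotone endpoint n(2^(n−1)−1)) — which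
force intercept e^(−n)√(2πn), slope e-per-bit and endpoint 2^n, i.e. the unique exponent log₂ e.
Imported areas: sharp analytic inequalities of Brascamp–Lieb/Hadamard type (analysis),
matrix-product-state compression with isometric memories (quantum information:
doi:10.1103/PhysRevB.73.094423, arXiv:0905.4822; the ABP law is "CLL with a w-dimensional isometric
memory", an optimisation over products of Stiefel manifolds), and Nisan's cut-rank theory
(Nisan1991Noncommutative), whose exact form here (flat flattening spectrum ⇒ corr² ≤ w/C(n,k), item
SingleCutBound) is provably (e/2)^n weaker than the truth at w = 1 — so the law is a non-rank,
non-counting phenomenon. No open route of the sub (FreeEnergyLift, TwistedDetRank,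
RyserTripartition, SummationBits, GCTMult, …) measures an angle to per or uses CLL/MPS compression;
the negatives index (3 refuted statements: elusive candidate curve, Grenet-rigidity uniqueness) is
untouched.

RANKED CRUXES. #0 CorrelationGap (target) — X: for every c, eventually in n, every fan-in-two
circuit over ℂ with ≤ n^c gates has 2·|Σ_σ coeff_(x_σ)(P.eval)|² ≤ n!·Σ_m |coeff_m(P.eval)|², i.e.
corr²(P.eval, per_n) ≤ 1/2. (why it might fail: Border-VH strength: per_n might sit in the
ℓ²-direction closure of poly-size outputs though not in VP; one poly-size family with corr² > 1/2
infinitely often (none known: DPs e^(k−n), twisted determinants ≤ n^n/n!², partial Glynn sums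
T·n!/n^n) kills X.) [Valiant1979, Burgisser2024, CarlenLiebLoss2006, JerrumSnir1982]
#2 CorrelationLaw (crux) — ONE NAT PER BIT (card K1, sharp exponent): there is C such that for all n
≥ 1 and every fan-in-two circuit P over ℂ in the x_ij, |Σ_σ coeff_(x_σ) P.eval|² ≤
C·n^C·e^(−n)·(size P + n²)^(1/ln 2)·n!·Σ_m |coeff_m P.eval|² — i.e. corr² ≤ C n^C e^(−n)
(s+n²)^(log₂ e): each doubling of size buys at most one of the n nats separating a generic
row-product from per_n. Implies L(per_n) ≥ 2^n/poly(n) (Ryser optimal as an identity) and, via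
SharpImpliesExp and LawImpliesGap, X. [difficulty: open-problem] (why it might fail: Depth may
concentrate mass on S_n by cancellations no ABP has; ANY exact algebraic circuit for per_n of size
(2−ε)^n refutes the exponent (none known — Björklund-type 2^(n−Ω(√(n/log n))) counts are bit-model
tabulations, not identities).) [CarlenLiebLoss2006, JerrumSnir1982, Glynn2010,
doi:10.4230/LIPIcs.SWAT.2016.17, Burgisser2000]
#3 ABPCorrelationLaw (crux) — THE ABP LAW (card K2), pure matrix form: there is C such that for all
n ≥ 1, all widths w, all A : [n] → [n] → ℂ^(w×w) and boundary vectors u, v ∈ ℂ^w, |Σ_(σ ∈ S_n)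
uᵀ(Π_i A_i(σ i))v|² ≤ C·n^C·e^(−n)·w^(1/ln 2)·n!·Σ_(φ : [n]→[n]) |uᵀ(Π_i A_i(φ i))v|². This is
exactly corr² ≤ C n^C e^(−n) w^(log₂ e) for layer-ordered set-multilinear ABPs (= row-ROABPs, the
model containing Ryser, Glynn and every subset/column DP; affine labels only add junk); w = 1 is
Carlen–Lieb–Loss Thm 1.1, w = 2^k is met by the k-column DP up to √((n−k)/n), w ≥ 2^n is trivial by
Cauchy–Schwarz. Exact reformulation: maximise ‖m_n‖²/n! over isometries U_i ∈ ℂ^((wn)×w), m_i =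
compress ∘ up-operator of the Boolean lattice — CLL with a w-dimensional isometric memory.
[difficulty: XL] (why it might fail: Per-layer compression losses are coupled (one bond vector can
align with several conditional permanent states); the DMRG optimum (card kit j000842/3, n ≤ 10, w ≤
16) already exceeds w^(log₂ e)·n!/n^n by 3–6% at w ≥ 8 — a super-polynomial excess kills it.)
[CarlenLiebLoss2006, Nisan1991Noncommutative, doi:10.1103/PhysRevB.73.094423, arXiv:0905.4822]
#4 MonotoneCorrelationLaw (crux) — THE MONOTONE LAW (card K3): there is C such that for all n ≥ 1
and every fan-in-two circuit P over ℝ≥0 (monotone: nonnegative constants, +, ×) in the x_ij, (Σ_σ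
coeff_(x_σ) P.eval)² ≤ C·n^C·e^(−n)·(size P + n²)^(1/ln 2)·n!·Σ_m (coeff_m P.eval)². A junk-robust
Jerrum–Snir theorem: their partition/rectangle argument pins the corr = 1 endpoint n(2^(n−1)−1)
exactly; with junk allowed the rectangles must be weighted by CLL-type sub-permanent masses (Thm
3.1). Calibrations: row products (s ≈ n²) n!/n^n, k-column DP e^(k−n) at s ≈ nk2^k, bucket DPs and
block products strictly inside. [difficulty: L] (why it might fail: JS's rectangle bound controls
exact computation only; a monotone circuit of size 2^k·poly(n) capturing more than e^k·n!/n^n·poly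
of the permutation mass (products of partial trackers; all tried so far lose) refutes it, and
CLL-weighting of rectangles may not sum.) [JerrumSnir1982, ChattopadhyayDattaGhosalMukhopadhyay2022,
CarlenLiebLoss2006, Valiant1979]
#5 ExpCorrelationLaw (crux) — EXCHANGE RATE LEFT FREE (the load-bearing weakening of
CorrelationLaw): there are C and 0 < θ < 1 such that for all n ≥ 1 and every fan-in-two circuit P
over ℂ, |Σ_σ coeff_(x_σ) P.eval|² ≤ C·(size P + n)^C·θ^n·n!·Σ_m |coeff_m P.eval|² — polynomial size
sees the permanent only at exponentially small squared cosine, with SOME polynomial exchange rate.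
CorrelationLaw ⇒ this (θ = 1/e, SharpImpliesExp) ⇒ X (LawImpliesGap); it survives a hypothetical
(2−ε)^n circuit for per_n, which would only re-fit θ and C. [deps: CorrelationLaw] [difficulty:
open-problem] (why it might fail: Still border-type: an exact formula for per_n of size 2^(o(n))
(unknown, not excluded by any theorem), or poly-size outputs whose angle to per_n decays slower than
every θ^n, refutes it while VP ≠ VNP survives.) [Burgisser2024, MulmuleySohoniSIAM2001,
Nisan1991Noncommutative, CarlenLiebLoss2006]
#9 SharpImpliesExp (support) — CorrelationLaw → ExpCorrelationLaw (θ = e^(−1); n^C (s+n²)^(1/ln 2) ≤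
(s+n)^(C+4) for n ≥ 1). Bookkeeping with Real.rpow. [difficulty: provable-now] [CarlenLiebLoss2006]
#9 LawImpliesGap (support) — ExpCorrelationLaw → CorrelationGap: for size ≤ n^c the factor
C(n^c+n)^C θ^n is eventually ≤ 1/2 (exponential beats polynomial). [difficulty: provable-now]
[Burgisser2000]
#9 GapRefutesPer (support) — CorrelationGap → per is not a VP family over ℂ: p-computability gives
fan-in-two circuits of size ≤ n^c + c ≤ n^(c+1) computing per_n exactly (complexity is attained:
ArithCircuit.exists_computes_size_eq_complexity), whose output has Σ_σ coeff = n! and Σ_m |coeff_m|²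
= n! (coeff_permMonomial_perPoly, support_perPoly), contradicting 2(n!)² ≤ (n!)². [difficulty:
provable-now] [Valiant1979, Burgisser2000]
#9 PerSelfCorrelation (support) — the normalisation anchor corr²(per_n, per_n) = 1: Σ_σ coeff_(x_σ)
per_n = n! and Σ_(m ∈ supp) |coeff_m per_n|² = n! (from perPoly_eq_sum_monomial /
card_support_perPoly). [difficulty: provable-now] [Burgisser2000, JerrumSnir1982]
#9 ProductAnchor (support) — the w = 1 / s ≈ n² intercept = Carlen–Lieb–Loss 2006 Thm 1.1 in
correlation form: for every complex n×n array a, |Σ_σ Π_i a_i(σ i)|²·n^n ≤ (n!)²·Π_i Σ_j |a_ij|²,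
i.e. corr²(Π_i Σ_j a_ij x_ij, per_n) ≤ n!/n^n with equality at flat rank-one a. Known theorem, not
in Mathlib; CLL's second proof is an elementary induction on the number of rows via the
sub-permanent ℓ²-bound Thm 3.1 (P(f_1..f_K) ≤ √C(N,K)·K!/N^(K/2)·Π|f_j|), the tool a prover of
ABPCorrelationLaw needs anyway. [difficulty: L] [CarlenLiebLoss2006]
#9 MonotoneDepthThree (support) — monotone set-multilinear ΣΠΣ obeys the law with exponent 1: for
nonnegative arrays a_t (t < T), (Σ_t Σ_σ Π_i a_t,i(σ i))²·n^n ≤ T·(n!)²·Σ_φ (Σ_t Π_i a_t,i(φ i))²,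
i.e. corr²(Σ_t Π_i ℓ_t,i) ≤ T·n!/n^n (ProductAnchor per term, ‖f‖² ≥ Σ_t Π‖a_t,i‖² by positivity of
cross terms, Cauchy–Schwarz). Against it Glynn's SIGNED ΣΠΣ reaches corr = 1 at T = 2^(n−1): the
depth-3 picture of "cancellation is worth exactly what width is worth". [difficulty: M]
[CarlenLiebLoss2006, Glynn2010, JerrumSnir1982]
#9 SingleCutBound (support) — what rank gives, exactly (flat spectrum + Eckart–Young/von Neumann):
for every cut S ⊆ [n] of the layers and every coefficient function of cut-rank ≤ w, c(φ) = Σ_(b<w)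
L_b(φ|S)·R_b(φ|Sᶜ), one has |Σ_σ c(σ)|²·C(n,|S|) ≤ w·n!·Σ_φ |c(φ)|² — the (S, Sᶜ) flattening M of
per_n satisfies M Mᵀ M = |S|!(n−|S|)!·M (all C(n,|S|) singular values equal), so width-w ABPs have
single-cut corr² ≤ w/C(n,|S|): base 2^(−n)√n at the balanced cut, (e/2)^n weaker than CLL at w = 1.
Documents that the law is not a rank statement. [difficulty: M] [Nisan1991Noncommutative,
doi:10.1103/PhysRevB.73.094423, EfremenkoGargOliveiraWigderson2018]

TWO-LAYER PLAN. Foreseen glued splits (k ≤ 3, depth 1), filed only when a crux moves: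
ABPCorrelationLaw ⇐ LeftCanonicalReformulation (γ_ABP(n,w) = max over isometries U_i of ‖m_n‖²/n!,
m_i = compress ∘ up-operator; w = 1 is literally CLL) → RowLossPotential (a Johnson-scheme potential
Φ(m_i) with Φ(m_(i+1)) ≤ e^(−1)·w^(log₂ e / n)-type per-row decay, Gram matrices of the conditional
permanent states P^(S) have explicit Johnson eigenvalues) → ABPCorrelationLaw.
MonotoneCorrelationLaw ⇐ WeightedRectangleBound (JS parse-tree rectangles A·B ⊆ mon(f) weighted by
CLL Thm 3.1 sub-permanent masses) → MonotoneSumming (the weights sum to ≤ s^(log₂ e)·poly) →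
MonotoneCorrelationLaw. CorrelationLaw ⇐ (structural normal form: size-s circuits ⇒ sums of ≤
s^(O(1)) products of ABP-like pieces at the permutation-monomial level) → ABPCorrelationLaw →
CorrelationLaw — the only foreseen bridge from K2 to K1, and the place the depth question lives.

KILL CRITERIA. ¬CorrelationGap (a polynomial-size circuit family with corr² > 1/2 infinitely often)
closes the route outright (`close --reason refuted:CorrelationGap`) and is itself a striking
positive result (per_n in the ℓ²-direction closure of VP-size outputs). ¬ExpCorrelationLaw with X
intact ⇒ the law is dead as a mechanism: retire unless the refuting family suggests a
sub-exponential but still vanishing profile worth a new thesis. ¬CorrelationLaw alone (e.g. an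
algebraic (2−ε)^n circuit for per_n, or signed depth beating e-per-bit) ⇒ pivot: re-fit the
exponent, keep ExpCorrelationLaw/X, record the refuting family as the new calibration.
¬ABPCorrelationLaw or ¬MonotoneCorrelationLaw (a super-polynomial excess over w^(log₂ e)·n!/n^n in
row-ABPs, or a monotone construction beating e^k·n!/n^n·poly at size 2^k) ⇒ the triple calibration
was a coincidence: drop the sharp law, keep only ExpCorrelationLaw → X, and lower the route's
staffing claim to "border-VH via angles". per ∉ VP proved elsewhere moots the assembly but not the
law (which asserts L(per_n) ≥ 2^n/poly, far beyond VH).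

NOT DECOMPOSED YET. The sharp-constant programme (card K4: γ_ABP(n,w) = Θ(1)·(n!/n^n)·w^(log₂ e)
uniformly in w ≤ 2^(n(1−ε)), non-power-of-two constructions, the 3–6% excess at w = 8–16) — numerics
first, statement later; the K-row sub-permanent tool (CLL Thm 3.1) as a separate support item; the
left-canonical/Stiefel reformulation of the ABP law and its Johnson-scheme potential (layer-2
children of ABPCorrelationLaw); any depth-4 or formula-specific rung between ABPs and general
circuits; the equivalence "γ(n, n^c) → 1 iff per ∈ closure" (border bookkeeping, not needed by the
assembly); characteristic p and real-vs-complex variants (the functional needs an archimedean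
absolute value; over ℝ the same statements are expected).

CHEAPEST FALSIFIER. Push the card's DMRG experiment (exact block maximisation of corr² over signed
width-w row-ABPs; Ryser subset sums for ⟨f, per⟩, doubled transfer matrices for ‖f‖²; scripts
exp1/exp2 of the card, kit j000732/j000842/j000843/j000844) to n = 11, 12 and w = 24, 32 with more
restarts: the law predicts best/(n!/n^n·w^(log₂ e)) = O(1) (observed 0.92–1.06 for n ≤ 10, w ≤ 16,
gain 56.4×/57.2× over four doublings against e⁴ = 54.6); a ratio growing geometrically in w or n at
fixed w is the first crack and refutes ABPCorrelationLaw's calibration long before any proof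
attempt. Second, a literature/expert lookup a refuter can do in an hour: is any exact algebraic
formula/circuit for per_n of size (2−ε)^n known over ℂ (as opposed to bit-model counting
algorithms)? A yes kills CorrelationLaw's exponent. I could not run kit in this unit (planner,
plancard mode); searchd was unavailable (rc 75) for the lookup, galaxy/frontier searches found
nothing.

NUMBERS. Intercept: n!/n^n = corr² of Π_i(Σ_j x_ij) ≈ √(2πn)·e^(−n) (CarlenLiebLoss2006 Thm 1.1 says
this is the sup over products of row forms). Slope: k-column DP, width 2^k, size ≈ n·k·2^k: corr² =
(n−k)!/(n−k)^(n−k) ≈ e^(k−n)√(2π(n−k)); bucket DP with buckets of size b: corr² = (b!/b^b)^(n/b) at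
width (b+1)^(n/b) (inside the law: b = 2 gives gain exponent 0.653n against allowed 0.79n; b = 3:
0.499n vs 0.666n). Endpoint: Ryser 2^n − 1 row-products, Glynn 2^(n−1) (corr = 1); monotone
⊗-complexity of per_n = n(2^(n−1)−1) exactly (JerrumSnir1982 §4.3, in tree:
JerrumSnir.le_prodCount_perPoly). Rank: single balanced cut allows corr² ≤ w·√(πn/2)·2^(−n)
(SingleCutBound), (e/2)^n ≈ 1.36^n above the truth at w = 1. Depth 3: monotone T terms ≤ T·n!/n^n
(exponent 1), 2-term parity formula Π r_i − Π(r_i − 2x_i1) reaches 2n!/(n^n − (n−2)^n) ≈ 2.31× base;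
signed must reach 1 at T = 2^(n−1) (exponent log₂ e forced). Card numerics (kit j000842 n = 8;
j000843 n = 9; j000844 n = 10 partial), signed optimum / (n!/n^n·w^(log₂ e)) for w =
1,2,3,4,6,8,12,16: n = 8: 1.00, .94, .97, .92, .99, 1.06, 1.04, 1.03; n = 9: 1.00, .94, .97, 1.00,
.97, 1.03, 1.05, 1.05; monotone optimum 6–28% below signed; cut bound / law = 1.7–8.5 in this range.
log₂ e = 1/ln 2 = 1.4427 (the Lean exponent `1 / Real.log 2`). Items at open: 13 (1 target, 4
cruxes, 7 support, 1 assembly).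

DEFINITION REQUESTS. After open: `permCorrSq n f : ℝ` (:= |Σ_σ coeff_(permMonomial σ) f|² / (n!·Σ_(m
∈ supp f) |coeff_m f|²), with `permMass` and `coeffNormSq`), topic
Summits/ValiantsHypothesis/ValiantsHypothesis/Theorems, so that layer-2 children can be stated over
a named functional (all items above inline it and stay as filed); optionally `rowABPCoeff n w A u v
φ := uᵀ(Π_i A_i(φ i))v`. Cite fact wanted later (not load-bearing): CarlenLiebLoss2006 Thm 3.1
(K-row sub-permanent ℓ² bound) under Literature/Analysis, as the tool for the ABP induction; bib key
CarlenLiebLoss2006 was added to references.bib in this session (commit 6cb14e38d5e4).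

Novelty: Searches (2026-08-15, this planner; the card's own 2026-08-15 searches are listed on the card): `lit
search` ×2 ("Carlen Lieb Loss inequality of Hadamard type for permanents", "permanent correlation
low complexity polynomials coefficient l2 norm approximation") — searchd rc 75 both times (service
unavailable; refuter please rerun); `lit vsearch` (held corpus, no-graph) "upper bound on the inner
product between the permanent polynomial and any polynomial computed by a small arithmetic circuit
or MPS of small bond dimension …" (10 docs, none relevant: transcendence, Jukna, numerics texts);
`lit galaxy search --star all` "Hadamard type for permanents" (3 pdf hits citing CLL:
Błaszczyszyn–Yogeshwaran–Yukich, Carlen's trace-inequality notes, Bristiel–Caputo — none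
complexity), "correlation with the permanent" (30 rows, all dental/other senses of "permanent");
`lit galaxy search --star pdf --mode bm25` "upper bound on the inner product between the permanent
polynomial and polynomials computed by small arithmetic circuits or ABPs in the l2 norm of
coefficients" (15: Mahajan–Rao small-space classes, Chatterjee–Kush–Saraf–Shpilka set-multilinear
ABP lower bounds CCC 2024, Gurjar–Korwar–Saxena ROABP PIT, EGOW rank barriers arXiv:1710.09502,
Nisan-type simulations — all exact-computation rank/PIT results, no coefficient-space angle) and
"maximal overlap between an MPS of bond dimension D and the symmetrised permutation state /
permanent tensor; boson-sampling MPS entanglement bounds" (1  [refs: 10.1145/322326.322341, 10.1103/PhysRevB.73.094423, 1710.09502, 2604.00746, 2507.16105, 2605.09551, math/0508096, 0905.4822, 2109.06941, 1701.05328, doi:10.1145/322326.322341, doi:10.1103/PhysRevB.73.094423, CarlenLiebLoss2006, JerrumSnir1982, ChattopadhyayDattaGhosalMukhopadhyay2022, GrochowKumarSaksSaraf2017]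

Barriers (technique_class: coefficient-correlation, analytic-inequalities, mps): - technique_class: coefficient-correlation, analytic-inequalities, mps
- Literature.Barriers.ValiantsHypothesis.AlgebraicNaturalProofs: the certificate is a SIGN condition
D_γ(c, c̄) = γ·n!·Σ|c_m|² − |Σ_σ c_σ|² ≥ 0 on size-s outputs, < 0 at per_n — constructive but NOT
large ({D_γ < 0} is an e^(−Ω(N))-measure cap around per's direction) and not a vanishing condition,
so succinct hitting sets (FSV Def. 1/Thm. 4, in tree as SuccinctHittingSetsForVP → no natural proof)
say nothing about it; conceded: a PROOF of CorrelationLaw may still pass through large properties of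
VP_s — the claim is about the certificate type and about CLL as a non-natural proof principle at the
bottom of the same law.
- Literature.Barriers.ValiantsHypothesis.RankMethods: not a rank of a linear image of f —
SingleCutBound is exactly what rank gives (base 2^(−n)√n) and the law's base e^(−n) is strictly
below it; EGOW's ceilings for sub-additive rank measures do not apply to a quadratic,
target-dependent functional; corr²(det_n) = 0 separates per/det maximally by construction.
- Literature.Barriers.ValiantsHypothesis.FullRankMultilinear: the ABP/monotone rungs are
set-multilinear models where full-rank/min-partition-rank methods stall at n²–n³ for circuits (and
the 2026 min-partition-rank barrier arXiv:2604.00746 for mABPs); the law does not certify rank of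
any partition matrix — it bounds an angle whose extremisers (flat rank-one products) have MINIMAL
rank; honest caveat: the only bridge foreseen from ABPs

History (route lifecycle, newest last):
- 2026-08-16T04:21:27Z · AUTO-CRUX (backfill): CorrelationGap — hypotheses of the deciding theorem that nothing in the route derives are cruxes (operator:999:1085951)
- 2026-08-22T06:22:11Z · DORMANT — reconciler: no traction for 5.1 d (last activity item-evidence-added at 2026-08-17T02:36:56Z); parked, not closed — `ledger route dormant route-ValiantsHypothes (operator:999:2564409)

sub-problem: ValiantsHypothesis · status: dormant · opened planner-plancard-ValiantsHypothesis-ValiantsH-2f623e72-0 2026-08-15T16:10:32Z · rev 2 · ledger route-ValiantsHypothesis-OneNatPerBit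
GENERATED by the gate from the ledger (D-0016/17). Provers cite these decls: `theorem foo : Summit.ValiantsHypothesis.ValiantsHypothesis.Theses.OneNatPerBit.<Decl> := …` in Summits/ValiantsHypothesis/ValiantsHypothesis/Theorems/<Name>.lean.
-/

namespace Summit.ValiantsHypothesis.ValiantsHypothesis.Theses.OneNatPerBit

open scoped BigOperators Topology Manifold Classical MeasureTheory ProbabilityTheory Matrix InnerProductSpace ComplexConjugate ContinuousMap
open Filter Set Function TopologicalSpace MeasureTheory

attribute [summit_statement] _root_.ValiantsHypothesis

open Literature.PNP

/-- item stmt-ValiantsHypothesis-10315 · crux (kind.auto-crux: conjecture-grade) · rank 0 · open · by planner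
why it might fail: Border-VH strength: per_n might sit in the ℓ²-direction closure of poly-size outputs though not in VP; one poly-size family with corr² > 1/2 infinitely often (none known: DPs e^(k−n), twisted determinants ≤ n^n/n!², partial Glynn sums T·n!/n^n) kills X.
sources: Valiant1979, Burgisser2024, CarlenLiebLoss2006, JerrumSnir1982
[target] X: for every c, eventually in n, every fan-in-two circuit over ℂ with ≤ n^c gates has
2·|Σ_σ coeff_(x_σ)(P.eval)|² ≤ n!·Σ_m |coeff_m(P.eval)|², i.e. corr²(P.eval, per_n) ≤ 1/2. -/
@[route_item "route-ValiantsHypothesis-OneNatPerBit", crux]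
def CorrelationGap : Prop :=
  ∀ c : ℕ, ∃ n₀ : ℕ, ∀ n ≥ n₀, ∀ P : Literature.Computability.AlgebraicComplexity.ArithCircuit ℂ (Fin n × Fin n), P.IsFanInTwo → P.size ≤ n ^ c → 2 * ‖∑ σ : Equiv.Perm (Fin n), MvPolynomial.coeff (Literature.Computability.AlgebraicComplexity.permMonomial σ) P.eval‖ ^ 2 ≤ (n.factorial : ℝ) * P.eval.support.sum (fun m => ‖MvPolynomial.coeff m P.eval‖ ^ 2)

/-- item stmt-ValiantsHypothesis-10316 · crux · rank 2 · open · by planner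
why it might fail: Depth may concentrate mass on S_n by cancellations no ABP has; ANY exact algebraic circuit for per_n of size (2−ε)^n refutes the exponent (none known — Björklund-type 2^(n−Ω(√(n/log n))) counts are bit-model tabulations, not identities).
sources: CarlenLiebLoss2006, JerrumSnir1982, Glynn2010, doi:10.4230/LIPIcs.SWAT.2016.17, Burgisser2000
[crux] ONE NAT PER BIT (card K1, sharp exponent): there is C such that for all n ≥ 1 and every
fan-in-two circuit P over ℂ in the x_ij, |Σ_σ coeff_(x_σ) P.eval|² ≤ C·n^C·e^(−n)·(size P +
n²)^(1/ln 2)·n!·Σ_m |coeff_m P.eval|² — i.e. corr² ≤ C n^C e^(−n) (s+n²)^(log₂ e): each doubling of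
size buys at most one of the n nats separating a generic row-product from per_n. Implies L(per_n) ≥
2^n/poly(n) (Ryser optimal as an identity) and, via SharpImpliesExp and LawImpliesGap, X.
[difficulty: open-problem] -/
@[route_item "route-ValiantsHypothesis-OneNatPerBit"]
def CorrelationLaw : Prop :=
  ∃ C : ℕ, ∀ n : ℕ, 1 ≤ n → ∀ P : Literature.Computability.AlgebraicComplexity.ArithCircuit ℂ (Fin n × Fin n), P.IsFanInTwo → ‖∑ σ : Equiv.Perm (Fin n), MvPolynomial.coeff (Literature.Computability.AlgebraicComplexity.permMonomial σ) P.eval‖ ^ 2 ≤ (C : ℝ) * (n : ℝ) ^ C * Real.exp (-(n : ℝ)) * ((P.size : ℝ) + (n : ℝ) ^ 2) ^ (1 / Real.log 2) * (n.factorial : ℝ) * P.eval.support.sum (fun m => ‖MvPolynomial.coeff m P.eval‖ ^ 2)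

/-- item stmt-ValiantsHypothesis-10317 · crux · rank 3 · open · by planner
why it might fail: Per-layer compression losses are coupled (one bond vector can align with several conditional permanent states); the DMRG optimum (card kit j000842/3, n ≤ 10, w ≤ 16) already exceeds w^(log₂ e)·n!/n^n by 3–6% at w ≥ 8 — a super-polynomial excess kills it.
sources: CarlenLiebLoss2006, Nisan1991Noncommutative, doi:10.1103/PhysRevB.73.094423, arXiv:0905.4822
[crux] THE ABP LAW (card K2), pure matrix form: there is C such that for all n ≥ 1, all widths w,
all A : [n] → [n] → ℂ^(w×w) and boundary vectors u, v ∈ ℂ^w, |Σ_(σ ∈ S_n) uᵀ(Π_i A_i(σ i))v|² ≤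
C·n^C·e^(−n)·w^(1/ln 2)·n!·Σ_(φ : [n]→[n]) |uᵀ(Π_i A_i(φ i))v|². This is exactly corr² ≤ C n^C
e^(−n) w^(log₂ e) for layer-ordered set-multilinear ABPs (= row-ROABPs, the model containing Ryser,
Glynn and every subset/column DP; affine labels only add junk); w = 1 is Carlen–Lieb–Loss Thm 1.1, w
= 2^k is met by the k-column DP up to √((n−k)/n), w ≥ 2^n is trivial by Cauchy–Schwarz. Exact
reformulation: maximise ‖m_n‖²/n! over isometries U_i ∈ ℂ^((wn)×w), m_i = compress ∘ up-operator of
the Boolean lattice — CLL with a w-dimensional isometric memory. [difficulty: XL] -/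
@[route_item "route-ValiantsHypothesis-OneNatPerBit"]
def ABPCorrelationLaw : Prop :=
  ∃ C : ℕ, ∀ n w : ℕ, 1 ≤ n → ∀ (A : Fin n → Fin n → Matrix (Fin w) (Fin w) ℂ) (u v : Fin w → ℂ), ‖∑ σ : Equiv.Perm (Fin n), u ⬝ᵥ ((List.ofFn fun i => A i (σ i)).prod *ᵥ v)‖ ^ 2 ≤ (C : ℝ) * (n : ℝ) ^ C * Real.exp (-(n : ℝ)) * (w : ℝ) ^ (1 / Real.log 2) * (n.factorial : ℝ) * ∑ φ : Fin n → Fin n, ‖u ⬝ᵥ ((List.ofFn fun i => A i (φ i)).prod *ᵥ v)‖ ^ 2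

/-- item stmt-ValiantsHypothesis-10318 · crux · rank 4 · open · by planner
why it might fail: JS's rectangle bound controls exact computation only; a monotone circuit of size 2^k·poly(n) capturing more than e^k·n!/n^n·poly of the permutation mass (products of partial trackers; all tried so far lose) refutes it, and CLL-weighting of rectangles may not sum.
sources: JerrumSnir1982, ChattopadhyayDattaGhosalMukhopadhyay2022, CarlenLiebLoss2006, Valiant1979
[crux] THE MONOTONE LAW (card K3): there is C such that for all n ≥ 1 and every fan-in-two circuit P
over ℝ≥0 (monotone: nonnegative constants, +, ×) in the x_ij, (Σ_σ coeff_(x_σ) P.eval)² ≤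
C·n^C·e^(−n)·(size P + n²)^(1/ln 2)·n!·Σ_m (coeff_m P.eval)². A junk-robust Jerrum–Snir theorem:
their partition/rectangle argument pins the corr = 1 endpoint n(2^(n−1)−1) exactly; with junk
allowed the rectangles must be weighted by CLL-type sub-permanent masses (Thm 3.1). Calibrations:
row products (s ≈ n²) n!/n^n, k-column DP e^(k−n) at s ≈ nk2^k, bucket DPs and block products
strictly inside. [difficulty: L] -/
@[route_item "route-ValiantsHypothesis-OneNatPerBit"]
def MonotoneCorrelationLaw : Prop :=
  ∃ C : ℕ, ∀ n : ℕ, 1 ≤ n → ∀ P : Literature.Computability.AlgebraicComplexity.ArithCircuit NNReal (Fin n × Fin n), P.IsFanInTwo → (∑ σ : Equiv.Perm (Fin n), ((MvPolynomial.coeff (Literature.Computability.AlgebraicComplexity.permMonomial σ) P.eval : NNReal) : ℝ)) ^ 2 ≤ (C : ℝ) * (n : ℝ) ^ C * Real.exp (-(n : ℝ)) * ((P.size : ℝ) + (n : ℝ) ^ 2) ^ (1 / Real.log 2) * (n.factorial : ℝ) * P.eval.support.sum (fun m => ((MvPolynomial.coeff m P.eval : NNReal) : ℝ) ^ 2)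

/-- item stmt-ValiantsHypothesis-10319 · crux · rank 5 · open · by planner
why it might fail: Still border-type: an exact formula for per_n of size 2^(o(n)) (unknown, not excluded by any theorem), or poly-size outputs whose angle to per_n decays slower than every θ^n, refutes it while VP ≠ VNP survives.
sources: Burgisser2024, MulmuleySohoniSIAM2001, Nisan1991Noncommutative, CarlenLiebLoss2006
[crux] EXCHANGE RATE LEFT FREE (the load-bearing weakening of CorrelationLaw): there are C and 0 < θ
< 1 such that for all n ≥ 1 and every fan-in-two circuit P over ℂ, |Σ_σ coeff_(x_σ) P.eval|² ≤
C·(size P + n)^C·θ^n·n!·Σ_m |coeff_m P.eval|² — polynomial size sees the permanent only at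
exponentially small squared cosine, with SOME polynomial exchange rate. CorrelationLaw ⇒ this (θ =
1/e, SharpImpliesExp) ⇒ X (LawImpliesGap); it survives a hypothetical (2−ε)^n circuit for per_n,
which would only re-fit θ and C. [deps: CorrelationLaw] [difficulty: open-problem] -/
@[route_item "route-ValiantsHypothesis-OneNatPerBit"]
def ExpCorrelationLaw : Prop :=
  ∃ (C : ℕ) (θ : ℝ), 0 < θ ∧ θ < 1 ∧ ∀ n : ℕ, 1 ≤ n → ∀ P : Literature.Computability.AlgebraicComplexity.ArithCircuit ℂ (Fin n × Fin n), P.IsFanInTwo → ‖∑ σ : Equiv.Perm (Fin n), MvPolynomial.coeff (Literature.Computability.AlgebraicComplexity.permMonomial σ) P.eval‖ ^ 2 ≤ (C : ℝ) * ((P.size : ℝ) + (n : ℝ)) ^ C * θ ^ n * (n.factorial : ℝ) * P.eval.support.sum (fun m => ‖MvPolynomial.coeff m P.eval‖ ^ 2)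

/-- item stmt-ValiantsHypothesis-10320 · support · rank 9 · closed · proved by Summit.ValiantsHypothesis.ValiantsHypothesis.Theorems.sharpImpliesExp_proof @ df74b65ad2fb (prover) · by planner
sources: CarlenLiebLoss2006
[support] CorrelationLaw → ExpCorrelationLaw (θ = e^(−1); n^C (s+n²)^(1/ln 2) ≤ (s+n)^(C+4) for n ≥
1). Bookkeeping with Real.rpow. [difficulty: provable-now] -/
@[route_item "route-ValiantsHypothesis-OneNatPerBit"]
def SharpImpliesExp : Prop :=
  CorrelationLaw → ExpCorrelationLaw

/-- item stmt-ValiantsHypothesis-10321 · support · rank 9 · closed · proved by Summit.ValiantsHypothesis.ValiantsHypothesis.Theorems.OneNatPerBit.lawImpliesGap_proof @ d812b17421f7 (prover) · by planner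
sources: Burgisser2000
[support] ExpCorrelationLaw → CorrelationGap: for size ≤ n^c the factor C(n^c+n)^C θ^n is eventually
≤ 1/2 (exponential beats polynomial). [difficulty: provable-now] -/
@[route_item "route-ValiantsHypothesis-OneNatPerBit"]
def LawImpliesGap : Prop :=
  ExpCorrelationLaw → CorrelationGap

/-- item stmt-ValiantsHypothesis-10322 · support · rank 9 · closed · proved by Summit.ValiantsHypothesis.ValiantsHypothesis.Theorems.gapRefutesPer_proof (prover) · by planner
sources: Valiant1979, Burgisser2000
[support] CorrelationGap → per is not a VP family over ℂ: p-computability gives fan-in-two circuits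
of size ≤ n^c + c ≤ n^(c+1) computing per_n exactly (complexity is attained:
ArithCircuit.exists_computes_size_eq_complexity), whose output has Σ_σ coeff = n! and Σ_m |coeff_m|²
= n! (coeff_permMonomial_perPoly, support_perPoly), contradicting 2(n!)² ≤ (n!)². [difficulty:
provable-now] -/
@[route_item "route-ValiantsHypothesis-OneNatPerBit", crux]
def GapRefutesPer : Prop :=
  CorrelationGap → ¬ Literature.Computability.AlgebraicComplexity.IsVPFamily (fun n => Literature.Computability.AlgebraicComplexity.perPoly (Fin n) ℂ)

/-- item stmt-ValiantsHypothesis-10323 · support · rank 9 · closed · proved by Summit.ValiantsHypothesis.ValiantsHypothesis.Theorems.OneNatPerBit.perSelfCorrelation_proof (prover) · by planner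
sources: Burgisser2000, JerrumSnir1982
[support] the normalisation anchor corr²(per_n, per_n) = 1: Σ_σ coeff_(x_σ) per_n = n! and Σ_(m ∈
supp) |coeff_m per_n|² = n! (from perPoly_eq_sum_monomial / card_support_perPoly). [difficulty:
provable-now] -/
@[route_item "route-ValiantsHypothesis-OneNatPerBit"]
def PerSelfCorrelation : Prop :=
  ∀ n : ℕ, (∑ σ : Equiv.Perm (Fin n), MvPolynomial.coeff (Literature.Computability.AlgebraicComplexity.permMonomial σ) (Literature.Computability.AlgebraicComplexity.perPoly (Fin n) ℂ)) = (n.factorial : ℂ) ∧ (Literature.Computability.AlgebraicComplexity.perPoly (Fin n) ℂ).support.sum (fun m => ‖MvPolynomial.coeff m (Literature.Computability.AlgebraicComplexity.perPoly (Fin n) ℂ)‖ ^ 2) = (n.factorial : ℝ)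

/-- item stmt-ValiantsHypothesis-10324 · support · rank 9 · closed · proved by Summit.ValiantsHypothesis.ValiantsHypothesis.Theorems.productAnchor_proof (prover) · by planner
sources: CarlenLiebLoss2006
[support] the w = 1 / s ≈ n² intercept = Carlen–Lieb–Loss 2006 Thm 1.1 in correlation form: for
every complex n×n array a, |Σ_σ Π_i a_i(σ i)|²·n^n ≤ (n!)²·Π_i Σ_j |a_ij|², i.e. corr²(Π_i Σ_j a_ij
x_ij, per_n) ≤ n!/n^n with equality at flat rank-one a. Known theorem, not in Mathlib; CLL's second
proof is an elementary induction on the number of rows via the sub-permanent ℓ²-bound Thm 3.1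
(P(f_1..f_K) ≤ √C(N,K)·K!/N^(K/2)·Π|f_j|), the tool a prover of ABPCorrelationLaw needs anyway.
[difficulty: L] -/
@[route_item "route-ValiantsHypothesis-OneNatPerBit"]
def ProductAnchor : Prop :=
  ∀ (n : ℕ) (a : Fin n → Fin n → ℂ), ‖∑ σ : Equiv.Perm (Fin n), ∏ i, a i (σ i)‖ ^ 2 * (n : ℝ) ^ n ≤ (n.factorial : ℝ) ^ 2 * ∏ i, ∑ j, ‖a i j‖ ^ 2

/-- item stmt-ValiantsHypothesis-10325 · support · rank 9 · closed · proved by Summit.ValiantsHypothesis.ValiantsHypothesis.Theorems.OneNatPerBitMonotoneDepthThree.monotoneDepthThree_proof @ d76edc7e4e3d (prover) · by planner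
sources: CarlenLiebLoss2006, Glynn2010, JerrumSnir1982
[support] monotone set-multilinear ΣΠΣ obeys the law with exponent 1: for nonnegative arrays a_t (t
< T), (Σ_t Σ_σ Π_i a_t,i(σ i))²·n^n ≤ T·(n!)²·Σ_φ (Σ_t Π_i a_t,i(φ i))², i.e. corr²(Σ_t Π_i ℓ_t,i) ≤
T·n!/n^n (ProductAnchor per term, ‖f‖² ≥ Σ_t Π‖a_t,i‖² by positivity of cross terms,
Cauchy–Schwarz). Against it Glynn's SIGNED ΣΠΣ reaches corr = 1 at T = 2^(n−1): the depth-3 picture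
of "cancellation is worth exactly what width is worth". [difficulty: M] -/
@[route_item "route-ValiantsHypothesis-OneNatPerBit"]
def MonotoneDepthThree : Prop :=
  ∀ (n T : ℕ) (a : Fin T → Fin n → Fin n → NNReal), (∑ t, ∑ σ : Equiv.Perm (Fin n), ∏ i, (a t i (σ i) : ℝ)) ^ 2 * (n : ℝ) ^ n ≤ (T : ℝ) * (n.factorial : ℝ) ^ 2 * ∑ φ : Fin n → Fin n, (∑ t, ∏ i, (a t i (φ i) : ℝ)) ^ 2

/-- item stmt-ValiantsHypothesis-10326 · support · rank 9 · closed · proved by Summit.ValiantsHypothesis.ValiantsHypothesis.Theorems.OneNatPerBitSingleCutBound.singleCutBound_proof @ 353ef77a6b7e (prover) · by planner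
sources: Nisan1991Noncommutative, doi:10.1103/PhysRevB.73.094423, EfremenkoGargOliveiraWigderson2018
[support] what rank gives, exactly (flat spectrum + Eckart–Young/von Neumann): for every cut S ⊆ [n]
of the layers and every coefficient function of cut-rank ≤ w, c(φ) = Σ_(b<w) L_b(φ|S)·R_b(φ|Sᶜ), one
has |Σ_σ c(σ)|²·C(n,|S|) ≤ w·n!·Σ_φ |c(φ)|² — the (S, Sᶜ) flattening M of per_n satisfies M Mᵀ M =
|S|!(n−|S|)!·M (all C(n,|S|) singular values equal), so width-w ABPs have single-cut corr² ≤
w/C(n,|S|): base 2^(−n)√n at the balanced cut, (e/2)^n weaker than CLL at w = 1. Documents that the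
law is not a rank statement. [difficulty: M] -/
@[route_item "route-ValiantsHypothesis-OneNatPerBit"]
def SingleCutBound : Prop :=
  ∀ (n w : ℕ) (S : Finset (Fin n)) (L : Fin w → (S → Fin n) → ℂ) (R : Fin w → ({i : Fin n // i ∉ S} → Fin n) → ℂ), ‖∑ σ : Equiv.Perm (Fin n), ∑ b, L b (fun i => σ i) * R b (fun i => σ i)‖ ^ 2 * (n.choose S.card : ℝ) ≤ (w : ℝ) * (n.factorial : ℝ) * ∑ φ : Fin n → Fin n, ‖∑ b, L b (fun i => φ i) * R b (fun i => φ i)‖ ^ 2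

/-- item stmt-ValiantsHypothesis-10327 · assembly · rank 1 · closed · proved by Summit.ValiantsHypothesis.Theorems.OneNatPerBit.assembly_proof @ 7b55018c4522 (prover) · by planner
sources: Valiant1979, Burgisser2000
[assembly] CorrelationGap → GapRefutesPer → ValiantsHypothesis (the hub facts per ∈ VNP and the
ofFintype bridge are proved theorems used inside the proof). -/
@[route_item "route-ValiantsHypothesis-OneNatPerBit"]
def Assembly : Prop :=
  CorrelationGap → GapRefutesPer → ValiantsHypothesis

/-! D-0027 §2.1 — DECIDING THEOREM (planner-authored via `route open/edit --closes-file`; by planner-plancard-ValiantsHypothesis-ValiantsH-2f623e72-0 2026-08-15T16:10:33Z):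
its hypotheses are this route's items and its conclusion the sub-problem Statement (glue_lint), and it elaborates with this file. -/

@[closes "route-ValiantsHypothesis-OneNatPerBit"] theorem closes (hX : CorrelationGap) (hR : GapRefutesPer) : _root_.ValiantsHypothesis := by
  have hnot := hR hX
  show Literature.Computability.AlgebraicComplexity.VP ℂ ≠ Literature.Computability.AlgebraicComplexity.VNP ℂ
  intro hEq
  apply hnot
  have hper : Literature.Computability.AlgebraicComplexity.perFamily ℂ ∈ Literature.Computability.AlgebraicComplexity.VP ℂ := by
    rw [hEq]; exact Literature.Computability.AlgebraicComplexity.perFamily_mem_VNP_holds ℂ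
  exact (Literature.Computability.AlgebraicComplexity.mem_VP_ofFintype_iff_holds _).1 hper

end Summit.ValiantsHypothesis.ValiantsHypothesis.Theses.OneNatPerBit
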